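import Literature.MathematicalPhysics.QuantumFieldTheory.Balaban1983to89.B6Eq295
import Literature.MathematicalPhysics.QuantumFieldTheory.Balaban1983to89.B6AdjointAveraging

/-!
# `Balaban1983to89.B6GaussianIdentity2119` — T. Bałaban, *Propagators and renormalization transformations for lattice
# gauge theories. II*, Commun. Math. Phys. **96** (1984) 223–250 [Balaban1984PropagatorsII], Sect. C (2.119) p. 243:
# the Gaussian identity `e^{½⟨J,GJ⟩} = exp[…]·Z″⁻¹∫dB Πδ_{Ax(y)}(B) exp[−½⟨Q″B,aQ″B⟩ − ½⟨B,Δ_jB⟩ + ⟨B,H_j*(J − …)⟩]`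
# DEFINING `Q″` — PROVED from (2.112) by the steps (2.113)–(2.118), and `Q″` TYPED on the concrete bond-field carrier

statement-level skeleton of published theorems with citation tags; proofs where landed; nothing here is a claim about the Yang–Mills mass gap

PDF held: `paper:balaban1984-cmp96-propagators-rt-ii` (journal page = PDF page + 222); the displays were read AS IMAGES on
the ×2 renders `run/shared/lean/pub/pub-balaban/b2b-balaban-ref1/pages/1984-cmp96-propagators-rt-II/…-p020, p021, p022-x2.png`
(pp. 242–244) by this seat (2026-08-21).

CITATION HEADER (lean-in-tree rule).  WHAT IS REPRODUCED: lit-balaban SKELETON row **B6.Eq2.119** (absent until now: *"the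
resulting identity … defining Q″"*; PHASE-2 seat p22, re-pointed by ruling G.5-18; owner r03, referee ref-4).  It CONTINUES
the sibling `…B6Eq295` §4 (rows B6.Eq2.111–2.116: the translation `A → A + H_jB` `eq2113_2114`, the constrained moment-generating
function `eq2115`, (2.116) `eq2116`), whose carriers and typing conventions are reused verbatim (δ-function integrals = integrals
over a parameter space of the constraint surface against a left-invariant measure; no integrability hypothesis — both sides are
junk together), and the sibling `…B6AdjointAveraging` (p. 248, whose reading (a) of `Q″` — *"sends a unit-lattice bond field B to
the pair (B↾_{Λ^c}, L^{(d−2)/2}(Q₁B)↾_{Λ′})"* — is the object typed in §2 on its own carriers `B4.Idx Ω d`, `B6BondElimination.avgQ`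
= (1.11) of [Balaban1984PropagatorsI], `adjQ`).  Nothing of either file is restated.

PRINT (p. 243 [PDF 21], verbatim).  *"This implies further
e^{½⟨J,GJ⟩} = e^{½⟨J,∂H′_jC^{(j)}_ΛH′_j*∂*J⟩}Z⁻¹Z′_j⁻¹Z′ · ∫dB exp[−½a Σ_{b∈Λ^c}|B(b)|² − ½aL^{d−2} Σ_{c∈Λ′}|(Q₁B)(c)|²] Π_{y∈Λ′}δ_{Ax(y)}(B)
· ∫dAδ(Q_jA − B) exp[−½⟨A,(Δ−∂P_j∂*)A⟩ + ⟨A, J − ∂ΔH′_jC^{(j)}_ΛH′_j*∂*J⟩]. (2.112)  In the last integral above we make the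
translation A → A + H_jB. … The translation gives the factor exp[−½⟨H_jB,(Δ−∂P_j∂*)H_jB⟩ + ⟨H_jB, J − ∂ΔH′_jC^{(j)}_ΛH′_j*∂*J⟩]
(2.113) and separates the integral over A: ∫dAδ(Q_jA)exp[−½⟨A,(Δ−∂P_j∂*)A⟩ + ⟨A, J − …⟩]. (2.114) Let us denote a covariance of
this Gaussian integral by G̃_j, then the integral is equal to Z̃_j exp[½⟨J − …, G̃_j(J − …)⟩]. (2.115) Let us notice also that
exp[−½⟨H_jB,(Δ−∂P_j∂*)H_jB⟩] = Z̃_j⁻¹∫dAδ(Q_jA − B)exp[−½⟨A,(Δ−∂P_j∂*)A⟩], (2.116) and that in the last integral we may replace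
the exponential gauge fixing term by the δ-function δ_R(R∂*A) using the Faddeev-Popov procedure. Then this integral gives the
factor exp[−½‖∂H_jB‖²] (2.117) by (1.47) and (1.64). Thus both factors are equal and in fact the quadratic forms are equal to
⟨B, Δ_jB⟩ given by (1.66) and satisfying (1.67): γ₀‖∂₁B‖² ≦ ⟨B,Δ_jB⟩ ≦ γ₁‖∂₁B‖². (2.118)  These calculations give
e^{½⟨J,GJ⟩} = exp[½⟨J, ∂H′_jC^{(j)}_ΛH′_j*∂*J⟩ + ½⟨J − ∂ΔH′_jC^{(j)}_ΛH′_j*∂*J, G̃_j(J − ∂ΔH′_jC^{(j)}_ΛH′_j*∂*J)⟩]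
· Z″⁻¹ ∫dB Π_{y∈Λ′}δ_{Ax(y)}(B) exp[−½⟨Q″B, aQ″B⟩ − ½⟨B, Δ_jB⟩ + ⟨B, H_j*(J − ∂ΔH′_jC^{(j)}_ΛH′_j*∂*J)⟩], (2.119)
where ½⟨Q″B, aQ″B⟩ is equal to the quadratic form in B in (2.112). Now let us consider the integral above. It is a Gaussian
integral defined by the quadratic form"* [p. 244] *"(we take a = 1) ‖B↾_{Λ^c}‖² + L^{−2}‖(Q₁B)↾_{Λ′}‖² + ⟨B, Δ_jB⟩ (2.120)"*.

WHAT IS TYPED / PROVED (no deferred proofs).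
§1 (abstract carriers of `…B6Eq295` §4; every hypothesis displayed).  `inner_integral_2119` — the B-integrand of (2.112)
   computed: `∫dAδ(Q_jA − B) e^{−½⟨A,MA⟩+⟨A,J′⟩} = Z̃_j e^{½⟨J′,G̃_jJ′⟩} · e^{−½⟨B,Δ_jB⟩ + ⟨B,H_j*J′⟩}` (`M = Δ − ∂P_j∂*`), from
   `eq2113_2114` + `eq2115` + the identification (2.116)–(2.118) `⟨H_jB, MH_jB⟩ = ⟨B, Δ_jB⟩` (hypothesis `h2118`: its proof in print
   is the Faddeev–Popov step (2.117) *"by (1.47) and (1.64)"* of [Balaban1984PropagatorsI], not typed in the tree) + adjointness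
   of `H_j*`; **`eq2119`** — (2.119) AS PRINTED, derived from (2.112) taken as the displayed hypothesis `h2112` (rows B6.Eq2.95–2.111
   carry (2.112)'s own derivation): with `J′ = J − K₂J` (`K₂ = ∂ΔH′_jC^{(j)}_ΛH′_j*∂*`), `K₁ = ∂H′_jC^{(j)}_ΛH′_j*∂*`, and the
   constant `Z″⁻¹ = (Z⁻¹Z′_j⁻¹Z′)·Z̃_j` (READING (a)).
§2 (concrete carriers of `…B6BondElimination`/`…B6AdjointAveraging`: unit bonds `B4.Idx Ω d`, coarse bonds `(Fin d → ℤ) × Fin d`,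
   `(Q₁B)(c) = avgQ L B c` = (1.11)).  **`qpp`** / `qppLin` — the operator `Q″`: `Q″B = (B↾_E, w·(Q₁B)↾_K)` (E = the bonds of Λ^c,
   K = the bonds of Λ′, `w = L^{(d−2)/2}`), a linear map into `(E ⊕ K) → ℝ`; **`half_qpp_form`** — its defining sentence
   *"½⟨Q″B, aQ″B⟩ is equal to the quadratic form in B in (2.112)"*: `½⟨Q″B, aQ″B⟩ = ½aΣ_{b∈E}|B(b)|² + ½aw²Σ_{c∈K}|(Q₁B)(c)|²`
   (`w² = L^{d−2}`: `half_qpp_form_printed`); `sum_mul_qppAdj` — `Q″`'s adjoint is `…B6AdjointAveraging`'s `Q″*(F,B′) = 1_EF +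
   w·Q₁*B′` (its reading (a), now a theorem about this `Q″`).
THE GAUSSIAN ENGINE IS NOT RE-PROVED HERE: the finite-dimensional Lebesgue facts behind "a covariance of this Gaussian integral"
and `Z̃_j` exist in the tree and are consumed by name where needed — `Beta.GaussianIntegral.integral_exp_neg_half_quadForm`
(`∫e^{−½vᵀAv} = √(2π)^{n}/√det A`), `B9SectECov.integral_exp_source` / `complete_square` / `genFun_eq` (completion of the square
with a source), `B9Eq3112.fibreGaussian` (the fibre `{QA = B}`), `B9SectECov.eq_3157` (covariance `C(C*ΔC)⁻¹C*` on a constraint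
surface) — so the hypotheses `hGt`/`hsol` (G̃_j ranges in `{Q_jA = 0}` and inverts the form there) and `Z̃_j` of §1 are realised by
`G̃_j = ι(ι*Mι)⁻¹ι*` in every kernel-basis frame `ι`.

READINGS (none is an objection to print).  (a) `Z″` is not spelled out in print; collecting the constants of (2.112) and (2.115)
gives `Z″⁻¹ = Z⁻¹Z′_j⁻¹Z′Z̃_j`, typed as the product `c · Z̃_j` with `c` the displayed constant of (2.112).  (b) The δ-functions:
`∫dAδ(Q_jA − B)F(A) = ∫ F(ιn + H_jB) dμ(n)` (`ι` onto `{Q_jA = 0}`, `μ` left-invariant; the fibre point `H_jB` as in print's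
translation) and `∫dB Πδ_{Ax(y)}(B)F(B) = ∫ F(ι_B m) dν(m)` for ANY parametrisation `ι_B` and measure `ν` (the B-integral is only
carried along), exactly as in `…B6Eq295`.  (c) `H_j` enters only through the critical-point property `(Δ−∂P_j∂*)H_jB ⊥ {Q_jA = 0}`
(`hcrit`, print: `= Q_j*ω`) and its adjoint `H_j*` (`hadj`); `G̃_j` through `hGt`/`hsol`.  (d) `Q″` is fixed by print only through
its quadratic form (cell GAPS G-adv4-13); §2 is reading (γ) of `…B6AdjointAveraging` with the coarse weight `w` free (`w² = L^{d−2}`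
in print), `a` a positive number.  (e) `≤`/junk conventions of `…B6Eq295` (no integrability assumed anywhere).
Unit `lit-balaban-p22` (PHASE-2 proof seat), HOME `run/shared/lean/pub/lit-balaban/`, 2026-08-21.
-/

noncomputable section

open MeasureTheory Finset Matrix
open scoped InnerProductSpace

namespace Literature.MathematicalPhysics.QuantumFieldTheory.Balaban1983to89.B6GaussianIdentity2119

/-! ## §1 (2.112) ⇒ (2.119) over the abstract carriers of `B6Eq295` -/

section Abstract

variable {A : Type*} [NormedAddCommGroup A] [InnerProductSpace ℝ A]
variable {W : Type*} [AddCommGroup W] [Module ℝ W]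
variable {N : Type*} [AddCommGroup N] [Module ℝ N] [MeasurableSpace N] [MeasurableAdd N]
variable {Bs : Type*} [NormedAddCommGroup Bs] [InnerProductSpace ℝ Bs]
variable {V : Type*} [NormedAddCommGroup V] [InnerProductSpace ℝ V]
variable {NB : Type*} [MeasurableSpace NB]

/-- **The B-integrand of (2.112), computed by (2.113)–(2.118).**  For `M` (= `Δ − ∂P_j∂*`) symmetric, the fibre
`{Q_jA = 0}` parametrised by `ι` with a left-invariant `μ`, `H_j` with the critical-point property `MH_jB ⊥ {Q_jA = 0}`
(`hcrit`), `G̃_j` a covariance of the constrained Gaussian (`hGt`, `hsol`), `H_j*` the adjoint of `H_j` (`hadj`), and the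
identification (2.116)–(2.118) `⟨H_jB,(Δ−∂P_j∂*)H_jB⟩ = ⟨B,Δ_jB⟩` (`h2118`; *"Thus both factors are equal and in fact the
quadratic forms are equal to ⟨B, Δ_jB⟩"*):
`∫dAδ(Q_jA − B) exp[−½⟨A,MA⟩ + ⟨A,J′⟩] = (e^{½⟨J′,G̃_jJ′⟩}·Z̃_j) · exp[−½⟨B,Δ_jB⟩ + ⟨B,H_j*J′⟩]`,
`Z̃_j = ∫dAδ(Q_jA) e^{−½⟨A,MA⟩}` — the product of the factor (2.113) and the value (2.115) of (2.114).
[cite: Balaban1984PropagatorsII, (2.113)–(2.118) p.243] -/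
theorem inner_integral_2119 (μ : Measure N) [μ.IsAddLeftInvariant] (ι : N →ₗ[ℝ] A) (M Gt : A →ₗ[ℝ] A)
    (T : A →ₗ[ℝ] N) (Q : A →ₗ[ℝ] W) (Hj : Bs →ₗ[ℝ] A) (Hjs : A →ₗ[ℝ] Bs) (Δj : Bs →ₗ[ℝ] Bs)
    (hM : ∀ x y : A, ⟪M x, y⟫_ℝ = ⟪x, M y⟫_ℝ) (hι : ∀ n, Q (ι n) = 0)
    (hcrit : ∀ (b : Bs) (v : A), Q v = 0 → ⟪v, M (Hj b)⟫_ℝ = 0)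
    (hGt : ∀ J, Gt J = ι (T J)) (hsol : ∀ (n : N) (J : A), ⟪ι n, M (Gt J)⟫_ℝ = ⟪ι n, J⟫_ℝ)
    (hadj : ∀ (b : Bs) (x : A), ⟪Hj b, x⟫_ℝ = ⟪b, Hjs x⟫_ℝ)
    (h2118 : ∀ b : Bs, ⟪Hj b, M (Hj b)⟫_ℝ = ⟪b, Δj b⟫_ℝ) (J' : A) (b : Bs) :
    ∫ n, Real.exp (-(1 / 2) * ⟪ι n + Hj b, M (ι n + Hj b)⟫_ℝ + ⟪ι n + Hj b, J'⟫_ℝ) ∂μ =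
      (Real.exp ((1 / 2) * ⟪J', Gt J'⟫_ℝ) * ∫ n, Real.exp (-(1 / 2) * ⟪ι n, M (ι n)⟫_ℝ) ∂μ) *
        Real.exp (-(1 / 2) * ⟪b, Δj b⟫_ℝ + ⟪b, Hjs J'⟫_ℝ) := by
  rw [B6Eq295.eq2113_2114 μ ι M Q hM hι (Hj b) (hcrit b) J', B6Eq295.eq2115 μ ι M Gt T hM hGt hsol J',
    h2118 b, hadj b J']
  ring

/-- **(2.119)** p. 243 [PDF 21], AS PRINTED, from (2.112): *"These calculations give
e^{½⟨J,GJ⟩} = exp[½⟨J, ∂H′_jC^{(j)}_ΛH′_j*∂*J⟩ + ½⟨J − ∂ΔH′_jC^{(j)}_ΛH′_j*∂*J, G̃_j(J − ∂ΔH′_jC^{(j)}_ΛH′_j*∂*J)⟩]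
· Z″⁻¹∫dB Π_{y∈Λ′}δ_{Ax(y)}(B) exp[−½⟨Q″B,aQ″B⟩ − ½⟨B,Δ_jB⟩ + ⟨B, H_j*(J − ∂ΔH′_jC^{(j)}_ΛH′_j*∂*J)⟩], (2.119) where ½⟨Q″B,aQ″B⟩ is
equal to the quadratic form in B in (2.112)."*  Typed reading: `E` (= `e^{½⟨J,GJ⟩}`) satisfies (2.112) — hypothesis `h2112`, with
the displayed constant `c = Z⁻¹Z′_j⁻¹Z′`, `K₁ = ∂H′_jC^{(j)}_ΛH′_j*∂*`, `K₂ = ∂ΔH′_jC^{(j)}_ΛH′_j*∂*` (so `J′ = J − K₂J`), the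
B-integral `∫dB Πδ_{Ax(y)}(B)(·) = ∫ (·)(ι_B m) dν(m)`, its quadratic weight already written `½⟨Q″B,aQ″B⟩` (abstract `Q″`, `a`;
the concrete `Q″` and the printed sums are §2), and the inner integral `∫dAδ(Q_jA − B)(·) = ∫ (·)(ιn + H_jB) dμ(n)`; the data
`M, ι, H_j, H_j*, G̃_j, Δ_j` as in `inner_integral_2119`.  Conclusion = (2.119) with `Z″⁻¹ = c·Z̃_j` (READING (a)).
[cite: Balaban1984PropagatorsII, (2.119) p.243] -/
theorem eq2119 (μ : Measure N) [μ.IsAddLeftInvariant] (ι : N →ₗ[ℝ] A) (M Gt : A →ₗ[ℝ] A)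
    (T : A →ₗ[ℝ] N) (Q : A →ₗ[ℝ] W) (Hj : Bs →ₗ[ℝ] A) (Hjs : A →ₗ[ℝ] Bs) (Δj : Bs →ₗ[ℝ] Bs)
    (hM : ∀ x y : A, ⟪M x, y⟫_ℝ = ⟪x, M y⟫_ℝ) (hι : ∀ n, Q (ι n) = 0)
    (hcrit : ∀ (b : Bs) (v : A), Q v = 0 → ⟪v, M (Hj b)⟫_ℝ = 0)
    (hGt : ∀ J, Gt J = ι (T J)) (hsol : ∀ (n : N) (J : A), ⟪ι n, M (Gt J)⟫_ℝ = ⟪ι n, J⟫_ℝ)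
    (hadj : ∀ (b : Bs) (x : A), ⟪Hj b, x⟫_ℝ = ⟪b, Hjs x⟫_ℝ)
    (h2118 : ∀ b : Bs, ⟪Hj b, M (Hj b)⟫_ℝ = ⟪b, Δj b⟫_ℝ)
    (ν : Measure NB) (ιB : NB → Bs) (Qpp : Bs →ₗ[ℝ] V) (a : V →ₗ[ℝ] V) (K₁ K₂ : A →ₗ[ℝ] A) (J : A) (E c : ℝ)
    (h2112 : E = Real.exp ((1 / 2) * ⟪J, K₁ J⟫_ℝ) * c *
      ∫ m, Real.exp (-(1 / 2) * ⟪Qpp (ιB m), a (Qpp (ιB m))⟫_ℝ) *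
        (∫ n, Real.exp (-(1 / 2) * ⟪ι n + Hj (ιB m), M (ι n + Hj (ιB m))⟫_ℝ + ⟪ι n + Hj (ιB m), J - K₂ J⟫_ℝ) ∂μ) ∂ν) :
    E = Real.exp ((1 / 2) * ⟪J, K₁ J⟫_ℝ + (1 / 2) * ⟪J - K₂ J, Gt (J - K₂ J)⟫_ℝ) *
        (c * ∫ n, Real.exp (-(1 / 2) * ⟪ι n, M (ι n)⟫_ℝ) ∂μ) *
      ∫ m, Real.exp (-(1 / 2) * ⟪Qpp (ιB m), a (Qpp (ιB m))⟫_ℝ - (1 / 2) * ⟪ιB m, Δj (ιB m)⟫_ℝ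
          + ⟪ιB m, Hjs (J - K₂ J)⟫_ℝ) ∂ν := by
  set J' : A := J - K₂ J with hJ'
  set Zt : ℝ := ∫ n, Real.exp (-(1 / 2) * ⟪ι n, M (ι n)⟫_ℝ) ∂μ with hZt
  have hfun : (fun m => Real.exp (-(1 / 2) * ⟪Qpp (ιB m), a (Qpp (ιB m))⟫_ℝ) *
      (∫ n, Real.exp (-(1 / 2) * ⟪ι n + Hj (ιB m), M (ι n + Hj (ιB m))⟫_ℝ + ⟪ι n + Hj (ιB m), J'⟫_ℝ) ∂μ)) =
      fun m => (Real.exp ((1 / 2) * ⟪J', Gt J'⟫_ℝ) * Zt) *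
        Real.exp (-(1 / 2) * ⟪Qpp (ιB m), a (Qpp (ιB m))⟫_ℝ - (1 / 2) * ⟪ιB m, Δj (ιB m)⟫_ℝ
          + ⟪ιB m, Hjs J'⟫_ℝ) := by
    funext m
    rw [inner_integral_2119 μ ι M Gt T Q Hj Hjs Δj hM hι hcrit hGt hsol hadj h2118 J' (ιB m), ← hZt,
      show -(1 / 2) * ⟪Qpp (ιB m), a (Qpp (ιB m))⟫_ℝ - (1 / 2) * ⟪ιB m, Δj (ιB m)⟫_ℝ + ⟪ιB m, Hjs J'⟫_ℝ =
        -(1 / 2) * ⟪Qpp (ιB m), a (Qpp (ιB m))⟫_ℝ + (-(1 / 2) * ⟪ιB m, Δj (ιB m)⟫_ℝ + ⟪ιB m, Hjs J'⟫_ℝ) by ring,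
      Real.exp_add (-(1 / 2) * ⟪Qpp (ιB m), a (Qpp (ιB m))⟫_ℝ)]
    ring
  rw [h2112, hfun, integral_const_mul, Real.exp_add]
  ring

end Abstract

/-! ## §2 The operator `Q″` on the concrete bond-field carrier, and its defining sentence -/

section Qpp

open B6BondElimination B6AdjointAveraging

variable {d : ℕ} {L : ℕ} {Ω : Finset (Fin d → ℤ)}

/-- (1.11) is linear: `(Q₁(B + B′))(c) = (Q₁B)(c) + (Q₁B′)(c)` (`avgQ_eq_sum_mult`). [cite: Balaban1984PropagatorsI, (1.11) p.19] -/
theorem avgQ_add (B B' : B4.Idx Ω d → ℝ) (c : (Fin d → ℤ) × Fin d) :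
    avgQ L (B + B') c = avgQ L B c + avgQ L B' c := by
  simp only [avgQ_eq_sum_mult, Pi.add_apply, mul_add, sum_add_distrib]

/-- (1.11) is linear: `(Q₁(rB))(c) = r(Q₁B)(c)`. [cite: Balaban1984PropagatorsI, (1.11) p.19] -/
theorem avgQ_smul (r : ℝ) (B : B4.Idx Ω d → ℝ) (c : (Fin d → ℤ) × Fin d) :
    avgQ L (r • B) c = r * avgQ L B c := by
  simp only [avgQ_eq_sum_mult, Pi.smul_apply, smul_eq_mul, mul_sum]
  exact sum_congr rfl fun b _ => by ring

/-- **The operator `Q″` of (2.119)** (*"where ½⟨Q″B, aQ″B⟩ is equal to the quadratic form in B in (2.112)"*, that form being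
`½aΣ_{b∈Λ^c}|B(b)|² + ½aL^{d−2}Σ_{c∈Λ′}|(Q₁B)(c)|²`): `Q″` sends a unit-lattice bond field `B` (variables `B4.Idx Ω d`) to the
pair `(B↾_E, w·(Q₁B)↾_K)` — `E` the unit bonds of `Λ^c`, `K` the bonds of `Λ′`, `(Q₁B)(c) = B6BondElimination.avgQ L B c`
((1.11) of [Balaban1984PropagatorsI]), `w = L^{(d−2)/2}` — read as one function on `E ⊕ K` (reading (a)/(γ) of
`…B6AdjointAveraging`; READING (d)). [cite: Balaban1984PropagatorsII, (2.119) p.243] -/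
def qpp (L : ℕ) (E : Finset (B4.Idx Ω d)) (K : Finset ((Fin d → ℤ) × Fin d)) (w : ℝ) (B : B4.Idx Ω d → ℝ) :
    ↥E ⊕ ↥K → ℝ :=
  Sum.elim (fun b => B b) (fun c => w * avgQ L B c)

variable {E : Finset (B4.Idx Ω d)} {K : Finset ((Fin d → ℤ) × Fin d)} {w : ℝ}

/-- `Q″B` on an identity bond `b ∈ E`: `(Q″B)(b) = B(b)`. [cite: Balaban1984PropagatorsII, (2.119) p.243] -/
@[simp] theorem qpp_inl (B : B4.Idx Ω d → ℝ) (b : ↥E) : qpp L E K w B (Sum.inl b) = B b := rfl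

/-- `Q″B` on a constraint bond `c ∈ K`: `(Q″B)(c) = w·(Q₁B)(c)`. [cite: Balaban1984PropagatorsII, (2.119) p.243] -/
@[simp] theorem qpp_inr (B : B4.Idx Ω d → ℝ) (c : ↥K) : qpp L E K w B (Sum.inr c) = w * avgQ L B c := rfl

/-- `Q″` as a LINEAR operator (additivity and homogeneity from those of (1.11)). [cite: Balaban1984PropagatorsII, (2.119) p.243] -/
def qppLin (L : ℕ) (E : Finset (B4.Idx Ω d)) (K : Finset ((Fin d → ℤ) × Fin d)) (w : ℝ) :
    (B4.Idx Ω d → ℝ) →ₗ[ℝ] (↥E ⊕ ↥K → ℝ) where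
  toFun := qpp L E K w
  map_add' B B' := by
    funext i
    cases i with
    | inl b => simp [qpp]
    | inr c => simp [qpp, avgQ_add, mul_add]
  map_smul' r B := by
    funext i
    cases i with
    | inl b => simp [qpp]
    | inr c => simp [qpp, avgQ_smul]; ring

/-- `qppLin` is `qpp`. [cite: Balaban1984PropagatorsII, (2.119) p.243] -/
@[simp] theorem qppLin_apply (B : B4.Idx Ω d → ℝ) : qppLin L E K w B = qpp L E K w B := rfl

/-- **The defining sentence of `Q″`** (p. 243, after (2.119)): `½⟨Q″B, aQ″B⟩ = ½aΣ_{b∈E}|B(b)|² + ½aw²Σ_{c∈K}|(Q₁B)(c)|²`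
— with `w² = L^{d−2}`, *"the quadratic form in B in (2.112)"* `½aΣ_{b∈Λ^c}|B(b)|² + ½aL^{d−2}Σ_{c∈Λ′}|(Q₁B)(c)|²`
(`⟨·,·⟩` = the unit-scale sum of products on `E ⊕ K`, `a` a number). [cite: Balaban1984PropagatorsII, (2.119) + (2.112) p.243] -/
theorem half_qpp_form (a : ℝ) (B : B4.Idx Ω d → ℝ) :
    (1 / 2) * (qpp L E K w B ⬝ᵥ (a • qpp L E K w B)) =
      (1 / 2) * a * ∑ b ∈ E, B b ^ 2 + (1 / 2) * a * w ^ 2 * ∑ c ∈ K, avgQ L B c ^ 2 := by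
  rw [dotProduct_smul, smul_eq_mul, dotProduct, Fintype.sum_sum_type]
  simp only [qpp_inl, qpp_inr]
  rw [Finset.sum_coe_sort E (fun b => B b * B b), Finset.sum_coe_sort K (fun c => w * avgQ L B c * (w * avgQ L B c))]
  have h1 : ∑ i ∈ E, B i * B i = ∑ b ∈ E, B b ^ 2 := sum_congr rfl fun b _ => by ring
  have h2 : ∑ i ∈ K, w * avgQ L B i * (w * avgQ L B i) = w ^ 2 * ∑ c ∈ K, avgQ L B c ^ 2 := by
    rw [mul_sum]
    exact sum_congr rfl fun c _ => by ring
  rw [h1, h2]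
  ring

/-- The same with the printed weight `w² = L^{d−2}` (`d ≥ 2`): `½⟨Q″B, aQ″B⟩ = ½aΣ_{b∈E}|B(b)|² + ½aL^{d−2}Σ_{c∈K}|(Q₁B)(c)|²`,
literally *"the quadratic form in B in (2.112)"*. [cite: Balaban1984PropagatorsII, (2.112) + (2.119) p.243] -/
theorem half_qpp_form_printed (a : ℝ) (hw : w ^ 2 = (L : ℝ) ^ (d - 2)) (B : B4.Idx Ω d → ℝ) :
    (1 / 2) * (qpp L E K w B ⬝ᵥ (a • qpp L E K w B)) =
      (1 / 2) * a * ∑ b ∈ E, B b ^ 2 + (1 / 2) * a * (L : ℝ) ^ (d - 2) * ∑ c ∈ K, avgQ L B c ^ 2 := by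
  rw [half_qpp_form, hw]

/-- **`Q″*` is the adjoint of `Q″`** — `…B6AdjointAveraging`'s reading (a) *"Q″*(F, B′)(b) = 1_E(b)F(b) + w·(Q₁*B′)(b)"*
(`adjQ` = Q₁*, adjoint of (1.11) by `sum_mul_adjQ`) is a theorem about this `Q″`:
`Σ_b B(b)·(Q″*(F,B′))(b) = ⟨Q″B, (F,B′)⟩` for every pair `(F, B′)`. [cite: Balaban1984PropagatorsII, (2.119) p.243 + (2.146) p.248] -/
theorem sum_mul_qppAdj (B F : B4.Idx Ω d → ℝ) (B' : (Fin d → ℤ) × Fin d → ℝ) :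
    ∑ p, B p * ((if p ∈ E then F p else 0) + w * adjQ L K B' p) =
      qpp L E K w B ⬝ᵥ Sum.elim (fun b : ↥E => F b) (fun c : ↥K => B' c) := by
  have h1 : ∑ p, B p * (if p ∈ E then F p else 0) = ∑ b ∈ E, B b * F b := by
    rw [← sum_filter_add_sum_filter_not univ (fun p => p ∈ E)]
    have hE : univ.filter (fun p : B4.Idx Ω d => p ∈ E) = E := by ext p; simp
    rw [hE, sum_eq_zero (s := univ.filter fun p => p ∉ E) (fun p hp => by simp [(mem_filter.mp hp).2]), add_zero]
    exact sum_congr rfl fun p hp => by simp [hp]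
  have h2 : ∑ p, B p * (w * adjQ L K B' p) = w * ∑ c ∈ K, avgQ L B c * B' c := by
    rw [← sum_mul_adjQ, mul_sum]
    exact sum_congr rfl fun p _ => by ring
  rw [dotProduct, Fintype.sum_sum_type]
  simp only [qpp_inl, qpp_inr, Sum.elim_inl, Sum.elim_inr, mul_add, sum_add_distrib, h1, h2,
    Finset.sum_coe_sort E (fun b => B b * F b), Finset.sum_coe_sort K (fun c => w * avgQ L B c * B' c), mul_sum]
  congr 1
  exact sum_congr rfl fun c _ => by ring

end Qpp

end Literature.MathematicalPhysics.QuantumFieldTheory.Balaban1983to89.B6GaussianIdentity2119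

end
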